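import Summits.ResolutionOfSingularities.ResolutionOfSingularities.Theorems.PurelyInseparableDim4ChartAtlasShearStraightening
import HarnessLib

/-!
# Purely inseparable four-folds `z^p + F(x₁, …, x₄)`: STRAIGHTENING THE FIBRE PART OF AN ENTRY, EXTRA CHARTS — on the chart `x_l` of the same
# blow-up the shear `σ_β` of the base reads as PK's shear `τ_l : yᵢ ↦ yᵢ + βᵢ·y_j` (cell `res-dim4-pi`, typ-2 g8; chart-dictionary side of typ-3 g8's
# E-V4-4 (a), second half: «on chart l ∈ T ∖ S″ it is PK's shear τ»)

[OURS · counted 0] (D-0157 DOOR 2; DR-157-C.) Companion of `…ChartAtlasShearStraightening` (p726051: main chart `j`). Here the EXTRA chart `l ∈ T`,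
`l ≠ j` (`j ∈ T`, as in E-V4-4: `j ∈ T ∩ S″`), with `b_l = 0` (the entry's point has no component along `x_l`: `l` is a bundle direction): PROVED (no `sorry`, no new axiom):

* `coordBlowupSubst_shear_extra` — `ψ_l ∘ σ_β = τ_l ∘ ψ_l`, `τ_l = [yᵢ ↦ yᵢ + βᵢ·y_j (i ∈ T ∖ {j, l})]` (p704887's shear of record);
* **`chartTransform_shear_extra`** — `chartTransform p T l (σ_β F) = τ_l (chartTransform p T l F)` for `T`-permissible `F`: the extra-chart state of
  the sheared reading is PK's sheared extra state (before cleaning; cleaning then acts on both sides alike).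

Nothing here is a statement about resolution of singularities in dimension ≥ 4 / characteristic `p` (NOT proved anywhere in this programme).
bears_on: LADDER-RESOLUTION:D157-DOOR2 (res-dim4-pi). Supports stmt-ResolutionOfSingularities-16155 (helper).
-/

-- every declaration of this summit lives under `Summit.ResolutionOfSingularities.ResolutionOfSingularities`
-- (summit = problem), which the duplicate-namespace linter flags; house convention (cf. the Target file).
set_option linter.dupNamespace false

noncomputable section

open MvPolynomial

namespace Summit.ResolutionOfSingularities.ResolutionOfSingularities.Theorems.PIDim4

open Literature.AlgebraicGeometry.Resolution

namespace ChartDictionary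

variable {K : Type} [Field K] {p : ℕ} {T : Finset (Fin 4)} {j l : Fin 4} {b : Fin 4 → K}

/-- **On the extra chart `x_l`, `ψ_l ∘ σ_β = τ_l ∘ ψ_l`** (`j, l ∈ T`, `l ≠ j`, `b_l = 0`). -/
theorem coordBlowupSubst_shear_extra [DecidableEq K] (hj : j ∈ T) (hl : l ∈ T) (hjl : j ≠ l) (hbl : b l = 0) (Q : MvPolynomial (Fin 4) K) :
    coordBlowupSubst K (T : Set (Fin 4)) l (aeval (fun i => if i ∈ T ∧ i ≠ j then X i + C (b i) * X j else (X i : MvPolynomial (Fin 4) K)) Q) =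
      aeval (fun i => if i ∈ T ∧ i ≠ j ∧ i ≠ l then X i + C (b i) * X j else (X i : MvPolynomial (Fin 4) K))
        (coordBlowupSubst K (T : Set (Fin 4)) l Q) := by
  classical
  have key : (coordBlowupSubst K (T : Set (Fin 4)) l).comp
      (aeval fun i => if i ∈ T ∧ i ≠ j then X i + C (b i) * X j else (X i : MvPolynomial (Fin 4) K)) =
      (aeval fun i => if i ∈ T ∧ i ≠ j ∧ i ≠ l then X i + C (b i) * X j else (X i : MvPolynomial (Fin 4) K)).comp
        (coordBlowupSubst K (T : Set (Fin 4)) l) := by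
    refine MvPolynomial.algHom_ext fun i => ?_
    rw [AlgHom.comp_apply, AlgHom.comp_apply, aeval_X]
    have hjT : coordBlowupSubst K (T : Set (Fin 4)) l (X j : MvPolynomial (Fin 4) K) = X l * X j :=
      coordBlowupSubst_X_of_mem_of_ne K _ l (Finset.mem_coe.mpr hj) hjl
    have hτj : aeval (fun i => if i ∈ T ∧ i ≠ j ∧ i ≠ l then X i + C (b i) * X j else (X i : MvPolynomial (Fin 4) K))
        (X j : MvPolynomial (Fin 4) K) = X j := by
      rw [aeval_X, if_neg (fun h => h.2.1 rfl)]
    have hτl : aeval (fun i => if i ∈ T ∧ i ≠ j ∧ i ≠ l then X i + C (b i) * X j else (X i : MvPolynomial (Fin 4) K))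
        (X l : MvPolynomial (Fin 4) K) = X l := by
      rw [aeval_X, if_neg (fun h => h.2.2 rfl)]
    by_cases hi : i ∈ T ∧ i ≠ j
    · rw [if_pos hi]
      by_cases hil : i = l
      · subst hil
        rw [hbl, C_0, zero_mul, add_zero, coordBlowupSubst_X_self, hτl]
      · rw [map_add, map_mul, coordBlowupSubst_C, coordBlowupSubst_X_of_mem_of_ne K _ l (Finset.mem_coe.mpr hi.1) hil, hjT, map_mul, hτl,
          aeval_X, if_pos (show i ∈ T ∧ i ≠ j ∧ i ≠ l from ⟨hi.1, hi.2, hil⟩)]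
        ring
    · rw [if_neg hi]
      by_cases hil : i = l
      · subst hil
        rw [coordBlowupSubst_X_self, hτl]
      · by_cases hiT : i ∈ T
        · have hij : i = j := by
            by_contra hij
            exact hi ⟨hiT, hij⟩
          subst hij
          rw [hjT, map_mul, hτl, hτj]
        · rw [coordBlowupSubst_X_of_not_mem K _ l (fun h => hiT (Finset.mem_coe.mp h)), aeval_X, if_neg (fun h => hiT h.1)]
  have h := congrArg (fun f : MvPolynomial (Fin 4) K →ₐ[K] MvPolynomial (Fin 4) K => f Q) key
  simp only [AlgHom.comp_apply] at h
  exact h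

/-- **The extra-chart state of the sheared reading is PK's sheared extra state**: `chartTransform p T l (σ_β F) = τ_l (chartTransform p T l F)` for
`T`-permissible `F`, `j, l ∈ T`, `j ≠ l`, `b_l = 0`. -/
theorem chartTransform_shear_extra [DecidableEq K] (hj : j ∈ T) (hl : l ∈ T) (hjl : j ≠ l) (hbl : b l = 0) {F : MvPolynomial (Fin 4) K}
    (hperm : (p : ℕ∞) ≤ CentreBlowup.ordAlong T F) :
    CentreBlowup.chartTransform p T l (aeval (fun i => if i ∈ T ∧ i ≠ j then X i + C (b i) * X j else (X i : MvPolynomial (Fin 4) K)) F) =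
      aeval (fun i => if i ∈ T ∧ i ≠ j ∧ i ≠ l then X i + C (b i) * X j else (X i : MvPolynomial (Fin 4) K))
        (CentreBlowup.chartTransform p T l F) := by
  classical
  have h1 := coordBlowupSubst_eq_X_pow_mul_chartTransform hl p _ (le_ordAlong_shear (b := b) hj hperm)
  rw [coordBlowupSubst_shear_extra hj hl hjl hbl, coordBlowupSubst_eq_X_pow_mul_chartTransform hl p F hperm, map_mul, map_pow, aeval_X,
    if_neg (fun h => h.2.2 rfl)] at h1
  exact (mul_left_cancel₀ (pow_ne_zero p (X_ne_zero l)) h1).symm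

end ChartDictionary

end Summit.ResolutionOfSingularities.ResolutionOfSingularities.Theorems.PIDim4

end
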